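import Literature.MathematicalPhysics.QuantumFieldTheory.Balaban1983to89.Beta.RemainderKernelFlatBridge
import Literature.MathematicalPhysics.QuantumFieldTheory.Balaban1983to89.Beta.RemainderDecay190Periodised

/-!
# NODE D's (190)-socket `Data190` INHABITED on the cube-torus model by the torus periodisations of Bałaban's FLAT
# `(Q′G′Q′*)⁻¹`, with ONE `Consts190` for ALL meshes — a k-uniform model inhabitant by an operator of [5]∕[3]
# (`Beta.RemainderKernelFlatData190`)

statement-level skeleton of published theorems with citation tags; proofs where landed; nothing here is a claim
about the Yang–Mills mass gap.

HONEST FRAMING (cell rule).  Bookkeeping for the k-uniform remainder chain of row (D4) (`RemainderConst` ⇐ ONE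
`ChainTFac190` instance, `Beta.RemainderDecay190`); discharges NOTHING of `BetaPertH`; NOT B12 Thm 2, NOT the continuum
limit, NOT Clay.  Unit `b2b-balaban-beta-an4` gen 100 (BINDER row D4 OWNER; cell pub-balaban).  Imports this gen's
`Beta.RemainderKernelFlatBridge` (the flat letters BY NAME from `B6QGQDecay237` ∕ `B6QGQLower276` ∕ `B4Sect5Exhaustion`) and
gen 96's `Beta.RemainderDecay190Periodised` (`exists_data190_of_periodised_cubes_supNorm`: the (190)-socket on the cube-torus
model from ONE periodised decaying `ℤ^d` kernel) ONLY; a composition BY NAME, [folklore] plumbing; no new estimate.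

WHAT.  `RemainderDecay190Periodised.exists_data190_of_periodised_cubes_supNorm` inhabits NODE D's socket `Data190 d Mc N _ q`
from a unit-lattice kernel `S` with `IsPeriodic₂ (N n·Mc) S` (every `n`), `Decay₂ S C δ` (`δ > 0`) and torus operators `dH n`
acting entrywise as `periodise₂ (N n·Mc) S`, under numerics on `q : Consts190` that involve ONLY `(C, δ)` and the carrier
constants.  `RemainderKernelFlatBridge` supplies `S = (Q′G′Q′*)⁻¹` (`fun y y′ => limInv ℤ^d (KerQGQ m a) (y,0) (y′,0)`) with
`IsPeriodic₂ 1` (hence every period) and `Decay₂ (cInv d a) (deltaInv d a∕d)` — BOTH FREE OF THE MESH `η = 1∕(m+1)`.  Hence: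
* §1  `isPeriodic₂_of_one` (translation invariance ⟹ every block period); `toLin_periodise₂_single` (the torus operator with
  matrix `periodise₂ s S` acts entrywise as that matrix).
* §2  **`exists_data190_flatQGQInv`** — for every dimension `d ≥ 1`, coupling `a > 0`, cube side `Mc`, torus family `N`, and
  EVERY mesh index `m`, with ANY `q` meeting the (m-FREE) numerics
  `q.δ15 ≤ 2δ`, `cInv·K₁(d,δ∕2)·K₁(d,δ∕4) ≤ q.Cst` (`δ = deltaInv d a∕d`) + the carrier numerics: `∃ D : Data190 d Mc N _ q` whose
  test vectors are the cube-restricted columns of the periodised `(Q′G′Q′*)⁻¹`; and **`exists_consts_data190_flatQGQInv`** —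
  ONE `q : Consts190`, written out as a function of `d, a` and the cube side `Mc`, `Valid` at the rate `δ∕(8Mc)`, serving ALL
  meshes `m`, all `N`: the k-UNIFORMITY of the flat letter made visible at the socket, with a usable budget.
WHAT IS *NOT* DONE: this is a MODEL inhabitant (the road's (4.4)-space cube-torus model, scalar, zero background); the kernel
is Bałaban's flat `(Q′G′Q′*)⁻¹` of [3] (2.74)–(2.79) ∕ [B9] (3.132) at `U = 1`, NOT the (182) derivative `δ𝐇∕δB` of [15] whose
(190) decay NODE D really consumes (at zero background and `B = 0` that derivative is the vector `H_k` of [5] (1.103) with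
the Landau-gauge term — the scalar `H` is in the tree on `ℤ^d` as `B5Hk103ScalarZd.kerH`, fine×unit, not bridged here); row D4 class UNCHANGED (instance 0∕1; critical-path width 0 = NODE O; D4 DISCHARGE NO DATE).
No `def`, no named fact, no `sorry`, standard axioms.
HONEST DEPENDENCY: continuum YM on T⁴ ⇐ BetaPertH ∧ nine spine estimates (0/9 proved); BetaPertH ⇐ (D1) ∧ (D4) ∧
CAP+tail; G-an2-4 gates asym, D1 and NE2/3/4.

Sources: [15] = T. Bałaban, Commun. Math. Phys. **102** (1985) 277–309 [Balaban1985Variational], (182) p. 307, (189)–(190)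
p. 308, Prop. 9 p. 309; [I] = Commun. Math. Phys. **109** (1987) [Balaban1987RG1], (4.4) p. 281, p. 282, (5.10) p. 293; [3] =
Commun. Math. Phys. **96** (1984) [Balaban1984PropagatorsII], (2.74)–(2.79) pp. 236–237; [B9] = Commun. Math. Phys. **99**
(1985) 389–434 [Balaban1985BackgroundPropagators], (3.132) p. 422; [5] = [Balaban1984PropagatorsI], (1.99)–(1.103) p. 34.
-/

namespace Literature.MathematicalPhysics.QuantumFieldTheory.Balaban1983to89.Beta.RemainderKernelFlatData190

open Literature.MathematicalPhysics.QuantumFieldTheory.Balaban1983to89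
open Literature.MathematicalPhysics.QuantumFieldTheory.Balaban1983to89.TreeLengthTorus (TPt TDom)
open Literature.MathematicalPhysics.QuantumFieldTheory.Balaban1983to89.B12Decay510Window (K₁ K₁_nonneg)
open Literature.MathematicalPhysics.QuantumFieldTheory.Balaban1983to89.B12Decay510Torus (tcubeOf)
open Literature.MathematicalPhysics.QuantumFieldTheory.Balaban1983to89.Beta
  (Kernel₂ Decay₂ IsPeriodic₂ RowBound compKer kdelta periodise₂ imageShift imageShift_apply)
open Literature.MathematicalPhysics.QuantumFieldTheory.Balaban1983to89.Beta.RemainderDecay190 (Data190 Consts190)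
open Literature.MathematicalPhysics.QuantumFieldTheory.Balaban1983to89.Beta.RemainderDecay190Periodised
  (exists_data190_of_periodised_cubes_supNorm)
open Literature.MathematicalPhysics.QuantumFieldTheory.Balaban1983to89.B4Sect5Exhaustion (limInv)
open Literature.MathematicalPhysics.QuantumFieldTheory.Balaban1983to89.B6QGQLower276 (KerQGQ)
open Literature.MathematicalPhysics.QuantumFieldTheory.Balaban1983to89.B6QGQDecay237 (cInv cInv_pos deltaInv deltaInv_pos)
open Literature.MathematicalPhysics.QuantumFieldTheory.Balaban1983to89.Beta.RemainderKernelFlatBridge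
  (qgqInv_decay qgqInv_transInv)

variable {d : ℕ}

/-! ## §1. Plumbing: translation invariance gives every period; the torus operator of a periodised kernel -/

/-- A translation-invariant kernel (`IsPeriodic₂ 1`) is jointly `s`-periodic for every `s`.
[cite: Slade2017, Lemma 2.2.2] [folklore] -/
theorem isPeriodic₂_of_one {S : Kernel₂ d} (h : IsPeriodic₂ 1 S) (s : ℕ) : IsPeriodic₂ s S := by
  intro x y m
  have e : ∀ z : Fin d → ℤ, imageShift s z m = imageShift 1 z (fun i => (s : ℤ) * m i) := by
    intro z; funext i; simp only [imageShift_apply]; push_cast; ring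
  rw [e x, e y]
  exact h x y _

/-- The linear map with matrix `periodise₂ s S` acts on `δ_b` as the column `b`: `(dH δ_b)(a) = Ŝ(a, b)`.
[cite: Balaban1987RG1, (5.10) p.293] [folklore] -/
theorem toLin_periodise₂_single {s : ℕ} [NeZero s] (S : Kernel₂ d) (a b : TPt d s) :
    Matrix.toLin' (Matrix.of fun a b : TPt d s => periodise₂ s S a b) (Pi.single b 1) a = periodise₂ s S a b := by
  rw [Matrix.toLin'_apply]
  simp [Matrix.mulVec, dotProduct, Pi.single_apply]

/-! ## §2. The socket inhabited by the periodised flat `(Q′G′Q′*)⁻¹`, k-uniformly -/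

section Socket

variable {Mc : ℕ} [NeZero Mc] {N : ℕ → ℕ} [∀ n, NeZero (N n)]

/-- **`Data190` FROM THE FLAT `(Q′G′Q′*)⁻¹`, ANY MESH, FIXED NUMERICS.**  For `d ≥ 1`, `a > 0`, mesh index `m` (`η = 1∕(m+1)`),
and any `q : Consts190` meeting numerics that involve only `cInv d a`, `deltaInv d a∕d` (m-FREE) and the carrier constants:
the torus operators `dH n := (periodise₂ (N n·Mc) (Q′G′Q′*)⁻¹)` (as linear maps on `TPt d (N n·Mc) → ℝ`) inhabit NODE D's
socket, with test vectors the cube-restricted columns. [cite: Balaban1985Variational, (190) p.308; Balaban1984PropagatorsII, p.237] [folklore] -/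
theorem exists_data190_flatQGQInv (hd : 1 ≤ d) (m : ℕ) {a : ℝ} (ha : 0 < a) (I : Type) (i₀ : I) (η L Mg R : ℕ → ℝ)
    (H : ℕ → Prop) {q : Consts190} {δr : ℝ} (hδr : 0 < δr) (hσ₀ : 0 < q.σ) (hcR : B6.c0 δr (q.σ / δr) ^ d ≤ q.cR)
    (hκB : 1 ≤ q.κB) (hδ15 : q.δ15 ≤ 2 * (deltaInv d a / d))
    (hCst : cInv d a * K₁ d (deltaInv d a / d / 2) * K₁ d (deltaInv d a / d / 4) ≤ q.Cst) (hm : 1 ≤ q.m) (hθ : 0 ≤ q.θ)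
    (hθM : q.θ * Mc ≤ 1) :
    ∃ D : Data190 d Mc N (fun n => TPt d (N n * Mc) → ℂ) q,
      ∀ (n : ℕ) (X : TDom d (N n)) (x : TPt d (N n * Mc)),
        D.hn n X x = fun x' : TPt d (N n * Mc) =>
          if tcubeOf (N n) Mc x' ∈ X.1 then
            ((Matrix.toLin' (Matrix.of fun u v : TPt d (N n * Mc) =>
                periodise₂ (N n * Mc) (fun y y' : Fin d → ℤ => limInv Set.univ (KerQGQ m a) (y, 0) (y', 0)) u v)
              (Pi.single x (1 : ℝ)) x' : ℝ) : ℂ)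
          else 0 := by
  have hd' : (0 : ℝ) < d := by exact_mod_cast hd
  have hδ : 0 < deltaInv d a / d := div_pos (deltaInv_pos d ha) hd'
  exact exists_data190_of_periodised_cubes_supNorm I i₀ η L Mg R H
    (fun n => Matrix.toLin' (Matrix.of fun u v : TPt d (N n * Mc) =>
      periodise₂ (N n * Mc) (fun y y' : Fin d → ℤ => limInv Set.univ (KerQGQ m a) (y, 0) (y', 0)) u v))
    (fun n => isPeriodic₂_of_one (qgqInv_transInv (d := d) m ha) _) (qgqInv_decay (d := d) m ha) hδ
    (fun n u v => toLin_periodise₂_single _ u v) hδr hσ₀ hcR hκB hδ15 hCst hm hθ hθM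

/-- **ONE VALID `Consts190` FOR ALL MESHES.**  With `δ := deltaInv d a∕d` and the cube side `Mc` (Bałaban's fixed `M` of
[I] §4), the explicit constants `q = ⟨Cst := cInv d a·K₁(d,δ∕2)·K₁(d,δ∕4), δ15 := 2δ, σ := δ∕8, τ := δ∕8, cR := B6.c0 (δ∕8) 1^d,
m := 1, θ := 1∕Mc, κB := 1⟩` — functions of `d`, `a`, `Mc` ONLY, never of the mesh — are `Valid` at the rate `δ∕(8·Mc)`
(`σ + τ = δ15∕8`, `δ₀ ≤ τθ`), and the socket `Data190 d Mc N _ q` is inhabited by the periodised flat `(Q′G′Q′*)⁻¹` for EVERY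
mesh index `m` and every torus family `N`: the k-uniformity of the flat letter, read at NODE D's socket with a usable budget.
[cite: Balaban1985Variational, (190) p.308; Balaban1984PropagatorsII, p.237] [folklore] -/
theorem exists_consts_data190_flatQGQInv (hd : 1 ≤ d) {a : ℝ} (ha : 0 < a) (Mc : ℕ) [NeZero Mc] :
    ∃ q : Consts190, q.Valid (deltaInv d a / d / 8 / Mc) ∧
      q.Cst = cInv d a * K₁ d (deltaInv d a / d / 2) * K₁ d (deltaInv d a / d / 4) ∧
      q.δ15 = 2 * (deltaInv d a / d) ∧ q.θ = 1 / Mc ∧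
      ∀ (N : ℕ → ℕ) [∀ n, NeZero (N n)] (m : ℕ) (I : Type) (_i₀ : I) (η L Mg R : ℕ → ℝ) (H : ℕ → Prop),
        ∃ D : Data190 d Mc N (fun n => TPt d (N n * Mc) → ℂ) q,
          ∀ (n : ℕ) (X : TDom d (N n)) (x : TPt d (N n * Mc)),
            D.hn n X x = fun x' : TPt d (N n * Mc) =>
              if tcubeOf (N n) Mc x' ∈ X.1 then
                ((Matrix.toLin' (Matrix.of fun u v : TPt d (N n * Mc) =>
                    periodise₂ (N n * Mc) (fun y y' : Fin d → ℤ => limInv Set.univ (KerQGQ m a) (y, 0) (y', 0)) u v)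
                  (Pi.single x (1 : ℝ)) x' : ℝ) : ℂ)
              else 0 := by
  have hd' : (0 : ℝ) < d := by exact_mod_cast hd
  have hδ : 0 < deltaInv d a / d := div_pos (deltaInv_pos d ha) hd'
  have hMc : (0 : ℝ) < Mc := by exact_mod_cast Nat.pos_of_ne_zero (NeZero.ne Mc)
  have hσ : 0 < deltaInv d a / d / 8 := by positivity
  refine ⟨{ Cst := cInv d a * K₁ d (deltaInv d a / d / 2) * K₁ d (deltaInv d a / d / 4),
            δ15 := 2 * (deltaInv d a / d), σ := deltaInv d a / d / 8, τ := deltaInv d a / d / 8,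
            cR := B6.c0 (deltaInv d a / d / 8) 1 ^ d, m := 1, θ := 1 / Mc, κB := 1 },
    ⟨?_, ?_, ?_, ?_, ?_, ?_, ?_⟩, rfl, rfl, rfl, fun N _ m I i₀ η L Mg R H => ?_⟩
  · exact mul_nonneg (mul_nonneg (cInv_pos d ha).le (K₁_nonneg d _)) (K₁_nonneg d _)
  · exact pow_nonneg (tsum_nonneg fun _ => (Real.exp_pos _).le) d
  · norm_num
  · norm_num
  · exact hσ.le
  · show deltaInv d a / d / 8 + deltaInv d a / d / 8 ≤ 2 * (deltaInv d a / d) / 8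
    linarith
  · show deltaInv d a / d / 8 / Mc ≤ deltaInv d a / d / 8 * (1 / Mc)
    rw [mul_one_div]
  · refine exists_data190_flatQGQInv hd m ha I i₀ η L Mg R H hσ hσ ?_ le_rfl le_rfl le_rfl le_rfl
      (by positivity) ?_
    · show B6.c0 (deltaInv d a / d / 8) (deltaInv d a / d / 8 / (deltaInv d a / d / 8)) ^ d
        ≤ B6.c0 (deltaInv d a / d / 8) 1 ^ d
      rw [div_self hσ.ne']
    · show 1 / (Mc : ℝ) * Mc ≤ 1
      rw [one_div_mul_cancel hMc.ne']

end Socket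

end Literature.MathematicalPhysics.QuantumFieldTheory.Balaban1983to89.Beta.RemainderKernelFlatData190
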